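import Mathlib
import Literature.MathematicalPhysics.QuantumFieldTheory.Luscher2010.TrivializingMaps
import Summits.Ventures.LatticeQCDFlow.TrivializingMaps.UniformRadius
import Summits.Ventures.LatticeQCDFlow.TrivializingMaps.Truncation
import Summits.Ventures.LatticeQCDFlow.TrivializingMaps.LuscherSeriesExistence
import Summits.Ventures.LatticeQCDFlow.TrivializingMaps.MassTransferContraction
import Summits.Ventures.LatticeQCDFlow.TrivializingMaps.LocalModeNorm
import Summits.Ventures.LatticeQCDFlow.TrivializingMaps.TheoremAReduction
import Summits.Ventures.LatticeQCDFlow.TrivializingMaps.LocalModeNormTheoremA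
import Summits.Ventures.LatticeQCDFlow.TrivializingMaps.UniformRadiusAllBeta
import HarnessLib

/-!
# The local mode norm obligation is EQUIVALENT to THEOREM A: completeness of the interface, and what the
# venture's open formal node really is (honesty note, kernel-checked)

HONEST FRAMING: exact (Metropolis-corrected) sampling algorithms for lattice gauge theory; figures of merit
are autocorrelation/cost numbers at stated couplings and volumes; no continuum-physics claim.

Proposed tree file: `Summits/Ventures/LatticeQCDFlow/TrivializingMaps/LocalModeNormEquivalence.lean` (venture
side; namespace `Summit.Ventures.LatticeQCDFlow.TrivializingMaps`). Definitions (two one-mode bookkeeping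
gadgets) and theorems only; no `sorry`, no new axioms; nothing is asserted about the conjectures
`LuscherGeometricGradientBound` (`Truncation.lean` §6) or `HasLocalModeNorm` (`LocalModeNorm.lean`).

## The theorem

For every orthonormal basis `B₀` of `𝔰𝔲(n)`:

  `hasLocalModeNorm_iff_luscherGeometricGradientBound : HasLocalModeNorm d n B₀ ↔ LuscherGeometricGradientBound d n`.

The direction `→` is `LocalModeNormTheoremA.lean` (contraction + iteration + the one-basis reduction). The
direction `←` is `hasLocalModeNorm_of_fixedBasisGradientBound` below, and its proof is TRIVIAL BOOKKEEPING:
`LocalModeNormData` quantifies existentially over the mode type, the weights, the Casimirs, the incidence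
structure, the mass profiles and the transfer amounts, and the axioms (T1)–(T3), (G) of
`MassTransferContraction.lean` only constrain that bookkeeping RELATIVE TO THE MASSES ONE DECLARES. So as soon
as the link gradients of `wilsonSk d L B₀ k` are bounded by `C ρ^{-k}`, the ONE-MODE data inhabit the structure:
one mode of weight `1` on every link (`ModeWeights.single`: Casimir `|E| + 1`, `κ = 1`), one interaction vertex
per link (`LinkComplex.single`: `D = 1`), `σ = 0`, `γ = 1`, `Γ = 2ρ⁻¹`, masses `μ_k = max C 0 · ρ^{-k}`,
transfer `2 μ_{k+1}` at every vertex (balance `(|E|+1) μ_{k+1} ≤ 2|E| μ_{k+1}` needs `|E| ≥ 1`; a lattice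
without links gets empty mode sets), rate `D Γ (1/κ + 8σ/γ) = 2ρ⁻¹ =: θ`, initial mass `N₀ = max C 0`.

## What this says about the obligation graph (THEORY-1 §17.4, corrected in §18)

* `HasLocalModeNorm d n B₀` is NOT a weaker statement than THEOREM A and NOT a statement of harmonic analysis
  in its own right: as a `Prop` it IS Theorem A, re-expressed as the existence of a mass-transfer bookkeeping.
  The Peter–Weyl dictionary in the docstring of `LocalModeNorm.lean` (modes = assignments of irreducible
  representations to links, `w = √Casimir`, `ν_k(π) = d_π ‖ŝ_k(π)‖₁`, `σ = σ_F`, …) describes the INTENDED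
  inhabitant — the one THEORY-1 §12 constructs on paper and the one the `Abelian*.lean` files construct in Lean
  for `U(1)` (modes = integer link vectors) — not a logically separate, smaller hypothesis. "THEOREM A is proved
  by the kernel modulo `HasLocalModeNorm`" (docstrings of `LocalModeNorm*.lean`) is a correct sentence that
  carries NO reduction of difficulty; the honest status word for both nodes is the same: OPEN (formal),
  proved on paper (THEORY-1 §12, second-seat reviewed).
* So the venture has ONE open formal node on this route, THEOREM A, available in kernel-checked EQUIVALENT
  typings — `LuscherGeometricGradientBound d n` (all series, all bases) ↔ the `wilsonSk` form ↔ the fixed-basis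
  form (`TheoremAReduction.lean`) ↔ `HasLocalModeNorm d n B₀` for any one (equivalently every) basis `B₀`
  (`hasLocalModeNorm_iff_of_suBasis`) — plus one SUFFICIENT typing, the anchored bound
  `LuscherAnchoredGeometricBound d n B₀ → LuscherGeometricGradientBound d n` (per-anchor norms; the form in which
  the `U(1)` analogue is kernel-checked), and its kernel-checked CONSEQUENCES: `LuscherUniformRadius d n β` for
  every `β` (`luscherUniformRadius_of_hasLocalModeNorm`, via `UniformRadiusAllBeta.lean`) and the log-depth law
  (`LogDepthWilsonFlowSampler.lean`).
* Positive content of the equivalence — COMPLETENESS: every proof of THEOREM A whatsoever factors through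
  `LocalModeNormData`, so the interface loses nothing, and `MassTransferContraction.lean` is exactly as strong as
  the theorem it serves. What distinguishes the intended inhabitant from the trivial one is that its masses
  are COMPUTED from `s_k` by a norm (`ν_k(π) = d_π ‖ŝ_k(π)‖₁`, with `|S k| > 1` modes, `σ > 0`, and the
  THEORY-1 §12.4 constants) instead of being read off a gradient bound — a distinction a `Prop` quantifying
  `∃ (data)` cannot see. A typing with teeth must quantify a mode calculus over a CLASS of functions (all link
  polynomials of all finite link sets) with the norm given as data and (F1)–(F5) as axioms about the class;
  that re-typing is specified in THEORY-1 §18 and is not built here (its only known instance needs Peter–Weyl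
  on `SU(n)`, absent from Mathlib — FANOUT-theory1 R-T1-10c).
-/

namespace Summit.Ventures.LatticeQCDFlow.TrivializingMaps

open Literature.MathematicalPhysics.QuantumFieldTheory
open Literature.MathematicalPhysics.QuantumFieldTheory.Luscher2010
open MassTransfer
open scoped Matrix Matrix.Norms.Frobenius ContDiff

noncomputable section

/-! ## §1. One-mode bookkeeping gadgets -/

namespace MassTransfer

variable (E : Type*) [Fintype E]

/-- The ONE-VERTEX-PER-LINK incidence structure on a finite link type `E`: the "plaquettes" are the links
themselves, the plaquette `e` consists of the single link `e`, and exactly one plaquette passes through each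
link (`D = 1`). A bookkeeping gadget (no geometric meaning). [ours] -/
def LinkComplex.single [DecidableEq E] : LinkComplex E E where
  plaqs := Finset.univ
  links e := {e}
  card_links_le e := by simp
  D := 1
  card_through_le e := Finset.card_le_one.mpr fun a ha b hb => by
    simp only [Finset.mem_filter, Finset.mem_univ, true_and, Finset.mem_singleton] at ha hb
    rw [← ha, ← hb]

/-- The ONE-MODE weights on a finite link type `E`: a single mode (index type `Unit`) of weight `1` on every
link, "Casimir" `|E| + 1`, `κ = 1` (so `κ · ∑_e w = |E| ≤ |E| + 1`). A bookkeeping gadget. [ours] -/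
def ModeWeights.single : ModeWeights E Unit where
  w _ _ := 1
  w_nonneg _ _ := zero_le_one
  c _ := Fintype.card E + 1
  κ := 1
  κ_pos := one_pos
  casimir_ge _ := by simp

variable {E}

/-- The one-link complex has every link as a plaquette. [ours] -/
@[simp] theorem LinkComplex.single_plaqs [DecidableEq E] : (LinkComplex.single E).plaqs = Finset.univ := rfl

/-- The plaquette `e` of the one-link complex consists of the link `e` alone. [ours] -/
@[simp] theorem LinkComplex.single_links [DecidableEq E] (e : E) : (LinkComplex.single E).links e = {e} :=
  rfl

/-- The one-link complex has `D = 1`. [ours] -/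
@[simp] theorem LinkComplex.single_D [DecidableEq E] : (LinkComplex.single E).D = 1 := rfl

/-- The one mode has weight `1` on every link. [ours] -/
@[simp] theorem ModeWeights.single_w (m : Unit) (e : E) : (ModeWeights.single E).w m e = 1 := rfl

/-- The one mode has Casimir constant `|E| + 1`. [ours] -/
@[simp] theorem ModeWeights.single_c (m : Unit) : (ModeWeights.single E).c m = Fintype.card E + 1 := rfl

/-- The one-mode weights have `κ = 1`. [ours] -/
@[simp] theorem ModeWeights.single_κ : (ModeWeights.single E).κ = 1 := rfl

/-- The one mode has total weight `|E|`. [ours] -/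
@[simp] theorem ModeWeights.single_tw (m : Unit) : (ModeWeights.single E).tw m = Fintype.card E := by
  simp [ModeWeights.tw]

/-- With one mode of weight `1`, the link mass of a profile `ν` on `S` is `∑_{n ∈ S} ν n` at every link.
[ours] -/
@[simp] theorem ModeWeights.single_linkMass (S : Finset Unit) (ν : Unit → ℝ) (e : E) :
    (ModeWeights.single E).linkMass S ν e = ∑ n ∈ S, ν n := by
  simp [ModeWeights.linkMass]

/-- The link mass of the empty mode set vanishes. [ours] -/
@[simp] theorem ModeWeights.linkMass_empty {M : Type*} (W : ModeWeights E M) (ν : M → ℝ) (e : E) :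
    W.linkMass ∅ ν e = 0 := by
  simp [ModeWeights.linkMass]

end MassTransfer

/-! ## §2. The trivial inhabitant: the fixed-basis geometric bound gives local mode norm data -/

/-- **The one-mode inhabitant (ours; PROVED).** If the link gradients of the constructed Wilson-action
Lüscher series in the basis `B₀` are bounded geometrically and uniformly in the volume,
`|∂_{e,T_a} S̃_W^{(k)}(ιU)| ≤ C ρ^{-k}` — the fixed-basis form of THEOREM A, i.e. the right-hand side of
`luscherGeometricGradientBound_iff_fixedBasis d n B₀` — then `HasLocalModeNorm d n B₀` holds, with `θ = 2ρ⁻¹`,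
`N₀ = max C 0` and, at every lattice size, the ONE-MODE data: `ModeWeights.single`, `LinkComplex.single`,
`σ = 0`, `γ = 1`, `Γ = 2ρ⁻¹`, masses `μ_k = max C 0 · ρ^{-k}`, transfer `2μ_{k+1}` at every vertex (empty
mode sets on a lattice without links). The axioms (T1)–(T3), (G) constrain the bookkeeping only relative to
the declared masses, so they are met trivially: `HasLocalModeNorm` is a re-expression of THEOREM A, not a
weaker hypothesis (module docstring). [ours] -/
theorem hasLocalModeNorm_of_fixedBasisGradientBound {d n : ℕ} {B₀ : SuBasis n}
    (h : ∃ ρ : ℝ, 0 < ρ ∧ ∃ C : ℝ, ∀ (L : ℕ) [NeZero L] (k : ℕ)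
      (U : GaugeConfig d L (Matrix.specialUnitaryGroup (Fin n) ℂ)) (e : Edge d L) (a : B₀.ι),
      |linkDeriv e (B₀.T a) (wilsonSk d L B₀ k) (WilsonFlow.coeConfig U)| ≤ C * ρ⁻¹ ^ k) :
    HasLocalModeNorm d n B₀ := by
  obtain ⟨ρ, hρ, C, hC⟩ := h
  refine ⟨2 * ρ⁻¹, max C 0, fun L _ => ?_⟩
  rcases isEmpty_or_nonempty (Edge d L) with hE | hE
  · -- a lattice without links (`d = 0`): empty mode sets, nothing to dominate
    exact ⟨{
      M := Unit
      P := Edge d L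
      K := LinkComplex.single (Edge d L)
      W := ModeWeights.single (Edge d L)
      σ := 0
      γ := 1
      Γ := 2 * ρ⁻¹
      S := fun _ => ∅
      μ := fun _ _ => 0
      T := fun _ _ _ _ _ => 0
      step := fun k =>
        { σ_nonneg := le_rfl
          γ_pos := one_pos
          Γ_nonneg := by positivity
          ν_nonneg := fun n hn => absurd hn (Finset.notMem_empty n)
          T_nonneg := fun _ _ _ _ _ => le_rfl
          gap := fun m hm => absurd hm (Finset.notMem_empty m)
          balance := fun m hm => absurd hm (Finset.notMem_empty m)
          emit := fun _ _ _ _ n hn => absurd hn (Finset.notMem_empty n)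
          local_off := fun _ _ _ _ _ hT _ _ => absurd rfl hT
          local_on := fun _ _ _ _ _ hT _ _ => absurd rfl hT
          tw_le := fun _ _ _ _ _ hT => absurd rfl hT }
      rate_le := by simp
      init_le := fun e => by simp
      dominates := fun k U e a => (hE.false e).elim }⟩
  · -- one mode of weight one on every link, masses `max C 0 · ρ^{-k}`
    have hcard : (1 : ℝ) ≤ Fintype.card (Edge d L) := by exact_mod_cast Fintype.card_pos_iff.mpr hE
    exact ⟨{
      M := Unit
      P := Edge d L
      K := LinkComplex.single (Edge d L)
      W := ModeWeights.single (Edge d L)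
      σ := 0
      γ := 1
      Γ := 2 * ρ⁻¹
      S := fun _ => Finset.univ
      μ := fun k _ => max C 0 * ρ⁻¹ ^ k
      T := fun k _ _ _ _ => 2 * (max C 0 * ρ⁻¹ ^ (k + 1))
      step := fun k =>
        { σ_nonneg := le_rfl
          γ_pos := one_pos
          Γ_nonneg := by positivity
          ν_nonneg := fun _ _ => by positivity
          T_nonneg := fun _ _ _ _ _ => by positivity
          gap := fun m _ => by
            rw [ModeWeights.single_c]
            exact le_add_of_nonneg_left (Nat.cast_nonneg _)
          balance := fun m _ => by
            have hx : (0 : ℝ) ≤ max C 0 * ρ⁻¹ ^ (k + 1) := by positivity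
            simp only [ModeWeights.single_c, LinkComplex.single_plaqs, LinkComplex.single_links,
              Finset.sum_const, Finset.card_singleton, Finset.card_univ, Fintype.card_unit, nsmul_eq_mul,
              Nat.cast_one, one_mul]
            nlinarith [mul_nonneg (sub_nonneg.mpr hcard) hx]
          emit := fun _ _ e' _ n _ => by
            simp only [Finset.sum_const, Finset.card_univ, Fintype.card_unit, nsmul_eq_mul, Nat.cast_one,
              one_mul, ModeWeights.single_w, mul_one]
            exact le_of_eq (by ring)
          local_off := fun _ _ _ _ _ _ _ _ => by simp
          local_on := fun _ _ _ _ _ _ _ _ => by simp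
          tw_le := fun _ _ _ _ _ _ => by simp }
      rate_le := by simp
      init_le := fun e => by
        simp only [ModeWeights.single_linkMass, Finset.sum_const, Finset.card_univ, Fintype.card_unit,
          nsmul_eq_mul, Nat.cast_one, one_mul, pow_zero, mul_one, le_refl]
      dominates := fun k U e a => by
        simp only [ModeWeights.single_linkMass, Finset.sum_const, Finset.card_univ, Fintype.card_unit,
          nsmul_eq_mul, Nat.cast_one, one_mul]
        exact (hC L k U e a).trans (mul_le_mul_of_nonneg_right (le_max_left _ _) (by positivity)) }⟩

/-! ## §3. The equivalences and the all-coupling radius -/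

/-- **`HasLocalModeNorm` is the fixed-basis form of THEOREM A (ours; PROVED).** [ours] -/
theorem hasLocalModeNorm_iff_fixedBasis (d n : ℕ) (B₀ : SuBasis n) :
    HasLocalModeNorm d n B₀ ↔
      ∃ ρ : ℝ, 0 < ρ ∧ ∃ C : ℝ, ∀ (L : ℕ) [NeZero L] (k : ℕ)
        (U : GaugeConfig d L (Matrix.specialUnitaryGroup (Fin n) ℂ)) (e : Edge d L) (a : B₀.ι),
        |linkDeriv e (B₀.T a) (wilsonSk d L B₀ k) (WilsonFlow.coeConfig U)| ≤ C * ρ⁻¹ ^ k :=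
  ⟨fixedBasisGradientBound_of_hasLocalModeNorm, hasLocalModeNorm_of_fixedBasisGradientBound⟩

/-- **`HasLocalModeNorm` is THEOREM A (ours; PROVED).** For every orthonormal basis `B₀` of `𝔰𝔲(n)`:
`HasLocalModeNorm d n B₀ ↔ LuscherGeometricGradientBound d n`. The obligation of `LocalModeNorm.lean` is a
re-expression of the conjecture, not a weaker hypothesis (module docstring). [ours] -/
theorem hasLocalModeNorm_iff_luscherGeometricGradientBound (d n : ℕ) (B₀ : SuBasis n) :
    HasLocalModeNorm d n B₀ ↔ LuscherGeometricGradientBound d n :=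
  (hasLocalModeNorm_iff_fixedBasis d n B₀).trans (luscherGeometricGradientBound_iff_fixedBasis d n B₀).symm

/-- The obligation does not depend on the basis. [ours] -/
theorem hasLocalModeNorm_iff_of_suBasis (d n : ℕ) (B₀ B₁ : SuBasis n) :
    HasLocalModeNorm d n B₀ ↔ HasLocalModeNorm d n B₁ :=
  (hasLocalModeNorm_iff_luscherGeometricGradientBound d n B₀).trans
    (hasLocalModeNorm_iff_luscherGeometricGradientBound d n B₁).symm

/-- **Lüscher's volume-uniform radius at every coupling, modulo the local mode norm (ours; PROVED).**
`HasLocalModeNorm d n B₀ → LuscherUniformRadius d n β` for every `β` (radius `ρ/|β|`). [ours] -/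
theorem luscherUniformRadius_of_hasLocalModeNorm {d n : ℕ} (B₀ : SuBasis n) (h : HasLocalModeNorm d n B₀)
    (β : ℝ) : LuscherUniformRadius d n β :=
  luscherUniformRadius_of_geometric (luscherGeometricGradientBound_of_hasLocalModeNorm B₀ h) β

end

end Summit.Ventures.LatticeQCDFlow.TrivializingMaps
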